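import Literature.MathematicalPhysics.QuantumLattice.FermiRG.BGM2006Sec2Lemma21Proof
import HarnessLib

/-!
# BGM 2006 §2.4 ⇒ BGM 2003 §1.2: the scale-`h` Fermi curves satisfy the dispersion hypotheses (2.8a)–(2.8c)

Companion of `BGM2006Sec2Lemma21Proof.lean` (Benfatto–Giuliani–Mastropietro, Ann. Henri Poincaré **7** (2006)
809 = arXiv:cond-mat/0507686, §2.4 Lemma 2.1 [cite: BenfattoGiulianiMastropietro2006, §2.4 Lemma 2.1 p0009:L39–L62])
and of `BGM2003Sectors.lean` (Ann. Henri Poincaré **4** (2003) 137 = arXiv:cond-mat/0207210, §1.2 (2.8a)–(2.8c),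
typed as the hypothesis block `BGM2003.DispersionHyp ε μ e₀ u` under which BGM 2003's sector Lemmas 7.1–7.5 are
PROVED in the tree); typer wave gate-hubbard-kl, seat t1.

BGM 2006 (§2.4, p0009:L30–L37 and the Remark after Lemma 2.1): "if (2.36) is true for `|U| ≤ U₀` with `U₀`
small enough, for any `h_β ≤ h ≤ 0`, then the same properties (1)–(3) above still hold (with slightly modified
constants) for the Fermi surfaces corresponding to the dispersion relations `ε_h(k⃗)` … the qualitative and
quantitative properties of the dispersion relation on scale `h` are the same as the free one" — i.e. `ε_h` is in
the class of BGM 2003 §1.2, whose sector geometry (BGM 2003 §7 = BGM 2006 App. A2) is then available at every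
scale.  This file PROVES exactly that packaging:

* `contDiff_top_bgmEffDisp` — `ε_h ∈ C^∞(ℝ²)` (from the slice smoothness in `BGMSmoothness`);
* `bgm2006_dispersionHyp` — for `-4 < μ < -2-√2`, admissible `e₀` and the constants `C` of (2.36) there are
  `c₀, ē > 0` such that, whenever `|U| ≤ U₀`, `|h_β|U₀ ≤ c₀`, `E_0 ≡ ε₀`, (2.36a) and (2.36) hold, EVERY scale
  `h_β ≤ h ≤ 0` gives `BGM2003.DispersionHyp (ε_h) μ ē (u_h)` with `u_h(θ, e) = levelRadius ε_h (μ + e) θ`: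
  the fields `u_pos`, `level`, `convex`, `radial`, `antipodal` are the clauses of the PROVED Lemma 2.1
  (`BGM2006_Lemma_2_1_holds`, read through the frame bridge `curvature_levelRadius`), `smooth_u` (joint `C^∞`
  in `(θ, e)` on an open shell) is the implicit-function theorem `contDiffAt_levelRadius_uncurry` at `n = ∞`,
  `periodic_u`/`symm` are unconditional (`levelRadius_add_two_pi`, `bgmEffDisp_neg`).

Consequently the tree theorems `BGM2003.lemma71_normalAngle_holds`, `lemma72_sectorPolar_holds`,
`lemma73_sectorBox_holds`, `lemma74_projection_holds`, `lemma75_parallelogram_holds` apply verbatim to the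
interacting scale-`h` Fermi curves `Σ^{(h)}(e)` of BGM 2006 (the curves of App. A2 (A2.6)–(A2.7)).
Everything is proved; no definitions, no named facts, no `sorry`, no instances, no notation.
-/

noncomputable section

open Real Set Filter
open scoped Topology

namespace Literature.MathematicalPhysics.QuantumLattice.FermiRG

/-- **`ε_h ∈ C^∞(ℝ²)`**: the effective dispersion (2.36c) inherits the smoothness of the slices
`k⃗ ↦ E_h(±π/β, k⃗)` (footnote ¹, formal `L = ∞` form of (2.36)). [cite: BenfattoGiulianiMastropietro2006, §2.4 (2.36c) p0008:L112] -/
theorem contDiff_top_bgmEffDisp {β U : ℝ} {C : ℕ → ℝ} {hβ : ℤ} {E : ℤ → ℝ × (Fin 2 → ℝ) → ℂ}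
    (hS : BGMSmoothness β U C hβ E) (h : ℤ) {n : ℕ∞} : ContDiff ℝ (n : WithTop ℕ∞) (bgmEffDisp β E h) := by
  have hsl : ∀ k₀ : ℝ, ContDiff ℝ ((⊤ : ℕ∞) : WithTop ℕ∞) (fun k : Fin 2 → ℝ => E h (k₀, k)) := fun k₀ =>
    contDiff_infty.2 fun m => hS.1 h k₀ m
  have hfun : bgmEffDisp β E h =
      ⇑Complex.reCLM ∘ fun k => (E h (π / β, k) + E h (-(π / β), k)) / 2 := by
    funext k; simp [bgmEffDisp]
  rw [hfun]
  exact (Complex.reCLM.contDiff.comp (((hsl _).add (hsl _)).div_const 2)).of_le (by exact_mod_cast le_top)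

/-- At `E_0 ≡ ε₀` the scale-`0` effective dispersion is the free band. [cite: BenfattoGiulianiMastropietro2006, §2.3 (2.18) p0007:L30] -/
theorem bgmEffDisp_zero_eq {E : ℤ → ℝ × (Fin 2 → ℝ) → ℂ} (hI : BGMInitial E) (β : ℝ) :
    bgmEffDisp β E 0 = sqDispersion := by
  funext k
  rw [bgmEffDisp, hI, hI]
  have : (((sqDispersion ((π / β, k) : ℝ × (Fin 2 → ℝ)).2 : ℝ) : ℂ) +
      ((sqDispersion ((-(π / β), k) : ℝ × (Fin 2 → ℝ)).2 : ℝ) : ℂ)) / 2 = ((sqDispersion k : ℝ) : ℂ) := by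
    push_cast; ring
  rw [this, Complex.ofReal_re]

/-- **The scale-`h` Fermi curves of BGM 2006 satisfy BGM 2003's dispersion hypotheses (2.8a)–(2.8c).**
For `-4 < μ < -2-√2`, admissible `e₀` and the constants `C` of (2.36) there are `c₀, ē > 0` such that under
`E_0 ≡ ε₀`, (2.36a), (2.36) for `h_β ≤ h ≤ 0`, `|U| ≤ U₀` and `|h_β|U₀ ≤ c₀`, every `ε_h` with its polar chart
`u_h(θ, e) = levelRadius ε_h (μ + e) θ` is a `BGM2003.DispersionHyp` with shell `ē` — BGM's "the same
properties (1)–(3) above still hold (with slightly modified constants) for the Fermi surfaces corresponding to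
the dispersion relations `ε_h`", so that BGM 2003 §7 / BGM 2006 App. A2 apply at every scale.
[cite: BenfattoGiulianiMastropietro2006, §2.4 Remark before Lemma 2.1 p0009:L30–L37 and Remark after it p0009:L64–L72] -/
theorem bgm2006_dispersionHyp (μ e₀ : ℝ) (hμ₁ : -4 < μ) (hμ₂ : μ < -2 - Real.sqrt 2)
    (he₀ : BGMAdmissibleE0 μ e₀) (C : ℕ → ℝ) :
    ∃ c₀ ebar : ℝ, 0 < c₀ ∧ 0 < ebar ∧
    ∀ (β U₀ U : ℝ) (hβ : ℤ), 0 < β → hβ ≤ 0 → |U| ≤ U₀ → |(hβ : ℝ)| * U₀ ≤ c₀ →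
    ∀ E : ℤ → ℝ × (Fin 2 → ℝ) → ℂ, BGMInitial E → BGMSymmetry E → BGMSmoothness β U C hβ E →
    ∀ h : ℤ, hβ ≤ h → h ≤ 0 →
      BGM2003.DispersionHyp (bgmEffDisp β E h) μ ebar
        (fun θ e => levelRadius (bgmEffDisp β E h) (μ + e) θ) := by
  obtain ⟨he₀pos, he₀hi, he₀lo⟩ := he₀
  -- Lemma 2.1's constants
  obtain ⟨c₀', ebar', c', c₁', c₂', hc₀', hebar', hc', hc₁', hc₁₂', hL⟩ :=
    BGM2006_Lemma_2_1_holds μ e₀ hμ₁ hμ₂ ⟨he₀pos, he₀hi, he₀lo⟩ C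
  -- the smallness needed by the joint implicit-function theorem on the open shell `|e| < 5e₀/8`
  have hπ3 := Real.pi_gt_three
  have hπ4 := Real.pi_lt_four
  set K₀ := |C 0| with hK₀
  set K₁ := |C 1| with hK₁
  have hK₀0 : 0 ≤ K₀ := abs_nonneg _
  have hK₁0 : 0 ≤ K₁ := abs_nonneg _
  set c := Real.sqrt e₀ / 2 with hc
  have hcpos : 0 < c := by rw [hc]; positivity
  have hcsq : c ^ 2 = e₀ / 4 := by rw [hc, div_pow, Real.sq_sqrt he₀pos.le]; norm_num
  set c₀ := min 1 (min (e₀ / (16 * (K₀ + 1))) (c / (4 * (K₁ + 1)))) with hc₀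
  have hc₀pos : 0 < c₀ := by rw [hc₀]; positivity
  have hc₀1 : c₀ ≤ 1 := by rw [hc₀]; exact min_le_left _ _
  have hc₀a : c₀ ≤ e₀ / (16 * (K₀ + 1)) := by rw [hc₀]; exact (min_le_right _ _).trans (min_le_left _ _)
  have hc₀b : c₀ ≤ c / (4 * (K₁ + 1)) := by rw [hc₀]; exact (min_le_right _ _).trans (min_le_right _ _)
  have hc₀sq : c₀ ^ 2 ≤ c₀ := by
    calc c₀ ^ 2 = c₀ * c₀ := sq c₀
      _ ≤ c₀ * 1 := mul_le_mul_of_nonneg_left hc₀1 hc₀pos.le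
      _ = c₀ := mul_one _
  set δ₀ := 2 * K₀ * c₀ with hδ₀
  set δ₁ := 2 * K₁ * c₀ ^ 2 with hδ₁
  have hδ₀0 : 0 ≤ δ₀ := by rw [hδ₀]; positivity
  have hδ₁0 : 0 ≤ δ₁ := by rw [hδ₁]; positivity
  have hδ₀e : δ₀ ≤ e₀ / 8 := by
    have h1 : K₀ * c₀ ≤ K₀ * (e₀ / (16 * (K₀ + 1))) := mul_le_mul_of_nonneg_left hc₀a hK₀0
    have h2 : K₀ * (e₀ / (16 * (K₀ + 1))) ≤ e₀ / 16 := by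
      rw [show K₀ * (e₀ / (16 * (K₀ + 1))) = e₀ / 16 * (K₀ / (K₀ + 1)) by field_simp]
      exact mul_le_of_le_one_right (by positivity) (div_le_one_of_le₀ (by linarith) (by positivity))
    rw [hδ₀]; linarith
  have hgap : 2 * δ₁ < 4 / π * c := by
    have h1 : (K₁ + 1) * c₀ ≤ (K₁ + 1) * (c / (4 * (K₁ + 1))) :=
      mul_le_mul_of_nonneg_left hc₀b (by positivity)
    have h2 : (K₁ + 1) * (c / (4 * (K₁ + 1))) = c / 4 := by field_simp
    have h3 : K₁ * c₀ ^ 2 ≤ K₁ * c₀ := mul_le_mul_of_nonneg_left hc₀sq hK₁0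
    have h4 : K₁ * c₀ ≤ (K₁ + 1) * c₀ := by linarith [hc₀pos.le]
    have h5 : c < 4 / π * c := by
      rw [lt_mul_iff_one_lt_left hcpos, lt_div_iff₀ Real.pi_pos]; linarith
    rw [hδ₁]; linarith
  clear_value K₀ K₁ c c₀ δ₀ δ₁
  refine ⟨min c₀' c₀, min ebar' (e₀ / 2), lt_min hc₀' hc₀pos, lt_min hebar' (by positivity), ?_⟩
  intro β U₀ U hβ hβpos hhβ hU hcU E hI hSym hS h hh₁ hh₀
  have L := hL β U₀ U hβ hβpos hhβ hU (hcU.trans (min_le_left _ _)) E hI hSym hS h hh₁ hh₀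
  have hcU' : |(hβ : ℝ)| * U₀ ≤ c₀ := hcU.trans (min_le_right _ _)
  -- the uniform `C⁰`/`C¹` closeness of `ε_h` to `ε₀`
  have H : (∀ k, |bgmEffDisp β E h k - sqDispersion k| ≤ δ₀) ∧
      (∀ k v, |fderiv ℝ (bgmEffDisp β E h) k v - fderiv ℝ sqDispersion k v| ≤ δ₁ * (|v 0| + |v 1|)) := by
    rcases eq_or_lt_of_le hhβ with hβ0 | hβlt
    · have h0 : h = 0 := le_antisymm hh₀ (by rw [← hβ0]; exact hh₁)
      rw [h0, bgmEffDisp_zero_eq hI β]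
      refine ⟨fun k => ?_, fun k v => ?_⟩
      · rw [sub_self, abs_zero]; exact hδ₀0
      · rw [sub_self, abs_zero]; positivity
    · have hβ1 : (1 : ℝ) ≤ |(hβ : ℝ)| := by
        rw [abs_of_nonpos (by exact_mod_cast hhβ)]
        have : (hβ : ℝ) ≤ -1 := by exact_mod_cast (show hβ ≤ -1 by omega)
        linarith
      have hU₀ : 0 ≤ U₀ := (abs_nonneg U).trans hU
      have hUc : |U| ≤ c₀ := by
        calc |U| ≤ U₀ := hU
          _ = 1 * U₀ := (one_mul _).symm
          _ ≤ |(hβ : ℝ)| * U₀ := mul_le_mul_of_nonneg_right hβ1 hU₀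
          _ ≤ c₀ := hcU'
      obtain ⟨-, h0, h1, -⟩ := bgmEffDisp_perturbation hI hS hh₁ hh₀
      refine ⟨fun k => (h0 k).trans ?_, fun k v => (h1 k v).trans ?_⟩
      · rw [hδ₀, hK₀]; exact mul_le_mul_of_nonneg_left hUc (by positivity)
      · have hU2 : U ^ 2 ≤ c₀ ^ 2 := by
          rw [← sq_abs U]; exact pow_le_pow_left₀ (abs_nonneg U) hUc 2
        rw [hδ₁, hK₁]
        exact mul_le_mul_of_nonneg_right (mul_le_mul_of_nonneg_left hU2 (by positivity)) (by positivity)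
  obtain ⟨h0, h1⟩ := H
  have hεtop : ContDiff ℝ ((⊤ : ℕ∞) : WithTop ℕ∞) (bgmEffDisp β E h) := contDiff_top_bgmEffDisp hS h
  -- levels `|e| < 5e₀/8` are admissible for the implicit function theorem
  have hlev : ∀ e : ℝ, e ∈ Ioo (-(5 * e₀ / 8)) (5 * e₀ / 8) →
      μ + e ∈ Ioo (c ^ 2 + δ₀ - 4) (-2 - Real.sqrt 2 - δ₀) := by
    intro e he
    rw [hcsq]
    exact ⟨by linarith [he.1], by linarith [he.2]⟩
  have hmin : ∀ e : ℝ, |e| ≤ min ebar' (e₀ / 2) → |e| ≤ ebar' := fun e he => he.trans (min_le_left _ _)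
  refine
    { e₀_pos := lt_min hebar' (by positivity)
      smooth_ε := hεtop
      smooth_u := ?_
      periodic_u := fun e θ => levelRadius_add_two_pi (bgmEffDisp β E h) (μ + e) θ
      u_pos := ⟨c', hc', fun θ e he => ((L.1 e (hmin e he)).2.2.2.2.1) θ⟩
      level := fun θ e he => ((L.1 e (hmin e he)).2.2.1 θ).2
      convex := ⟨c', hc', fun θ e he => ?_⟩
      radial := ⟨c₁', c₂', hc₁', hc₁₂', fun θ e he => L.2.1 e θ (hmin e he)⟩
      symm := fun p => bgmEffDisp_neg hSym β h p
      antipodal := fun θ e _ => levelRadius_bgmEffDisp_add_pi hSym β h (μ + e) θ }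
  · -- joint smoothness on the open shell `|e| < 5e₀/8`
    refine ⟨5 * e₀ / 8, lt_of_le_of_lt (min_le_right _ _) (by linarith), ?_⟩
    intro p hp
    obtain ⟨-, hp2⟩ := hp
    have h2top : (2 : WithTop ℕ∞) ≤ ((⊤ : ℕ∞) : WithTop ℕ∞) := WithTop.coe_le_coe.mpr le_top
    have hjoint := contDiffAt_levelRadius_uncurry (n := ((⊤ : ℕ∞) : WithTop ℕ∞)) hεtop
      h2top h0 h1 hδ₁0 hgap (θ := p.1) (hlev p.2 hp2)
    have hG : ContDiff ℝ ((⊤ : ℕ∞) : WithTop ℕ∞) (fun q : ℝ × ℝ => ((μ + q.2, q.1) : ℝ × ℝ)) :=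
      (contDiff_const.add contDiff_snd).prodMk contDiff_fst
    have hcomp := hjoint.comp p (hG.contDiffAt)
    exact hcomp.contDiffWithinAt
  · -- convexity, read through the frame bridge
    rw [curvature_levelRadius]
    exact ((L.1 e (hmin e he)).2.2.2.2.2) θ

end Literature.MathematicalPhysics.QuantumLattice.FermiRG

end
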